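import Summits.QuantumFields.YangMills.Theorems.UnitScaleTiltProp8HalvingDressedCriticality
import HarnessLib

/-!
# Route `UnitScaleTilt`, crux K1 child «MinimiserStabilityRegPr» (stmt-QuantumFields-19200), registered stub V2′ `stub_halvingStep`
# (skeletons v8 5b4e846794b80374 ∕ v10 `BirthV10`) — **CRITICALITY OF THE DRESSED FUNCTIONAL, 𝔰𝔲(2)-VALUED COMPETITORS** (owner RULING g26-№3, repair (R3) of the
# seat's LOCATED ✗ on ✓ p605698 `HalvingDressedCriticality.tracePairing_of_isMinOn_dressed_wilson`: its `SU(2)`-chart hypothesis on `T = {self-adjoint ∧ constraints ∧ S₀}`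
# is unsatisfiable; HERE `T_𝔰𝔲` adds «bondwise traceless» and the test matrices are traceless — the (i)-supplier for ✓ `HalvingA1Row165TraceSU2.row165_of_tracePairing_L5_su2`
# at the DRESSED current `W = W₀∘(1 − H∘D) + E`)

Cell `ym3-torus` (HUMAN RULING D-0037, YM ladder rung R3 — continuum SU(2) YM₃ on the torus is a RUNG, not the Clay problem), width seat
`ym-ust-19200-w7` gen 0 (D-0154 (3c)).  `--supports stmt-QuantumFields-19200 --as helper`; def-free, 0 sorry, standard axioms.

WHY ∕ WHAT.  Word for word ✓ p605698 §3 with the competitor set `T_𝔰𝔲 = {X | (∀ b, IsSelfAdjoint (X b)) ∧ (∀ b, tr X(b) = 0) ∧ (∀ c, Q_{j(c)}X(c) = B(c)) ∧ X ∈ S₀}`, the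
minimiser `A` bondwise traceless, and the conclusions for every self-adjoint TRACELESS `Et` (the segment `A + t·(s•Et)` then stays in `T_𝔰𝔲`):
* ★ `tracePairing_of_isMinOn_dressed_su2` — from a minimum of `X ↦ Re S(X − H(D X))` over `T_𝔰𝔲` (abstract `S` with the gradient identity; no chart);
* ★★ `tracePairing_of_isMinOn_dressed_wilson_su2` — from a minimum of the tree's `wilsonAction4 ∘ U` for an `SU(2)`-chart `↑(U X)(b) = e^{iη(X − H(D X))(b)}` on `T_𝔰𝔲`
  (SATISFIABLE when `X − H(D X)` is 𝔰𝔲(2)-valued on `T_𝔰𝔲`: `exp(i·𝔰𝔲(2)) ⊂ SU(2)` — the instantiator's chart).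
HONEST SCOPE as in p605698: exact first-order calculus; the minimiser, the chart, `H`, `D` are hypotheses.  NOT a claim about the stub, the crux, the rung or the mass gap.

References: T. Bałaban, CMP **102** (1985) 277–309 [Balaban1985Variational] (5) p.278, (47) p.285, (80)–(89) pp.290–291, (99)–(100) p.293, (127) p.297, (157)–(158) p.302.
-/

set_option autoImplicit false

noncomputable section

open scoped BigOperators Matrix Matrix.Norms.L2Operator
open NormedSpace

namespace Summit.QuantumFields.YangMills.Theorems.HalvingDressedCriticalitySU2

open Literature.MathematicalPhysics.QuantumFieldTheory.Balaban1983to89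
open B6SectADomainsV1 (Domains)
open B6SectAOperatorsV1 (BondIdx QE QE_apply)
open LatticeFieldCalculus (bondAvgIter)
open Literature.MathematicalPhysics.QuantumFieldTheory.BalabanImbrieJaffe1984to88.BIJ85AxialPropagator411 (bondAvgIter_add bondAvgIter_smul)
open FlatActionCritical (re_fderiv_eq_zero_of_isMinOn_segment)
open FlatActionGradient (wilsonAction4_eq_re_action)
open HalvingDressedCriticality (fderiv_dressed_eq_pairing differentiableAt_dressed)

section Minimality

variable {P : Params} {β' : Type*} [Fintype β']

/-- ★ **THE TRACE PAIRING ON `ker Q` FOR THE DRESSED CURRENT, 𝔰𝔲(2)-VALUED COMPETITORS** — ✓ p605698 `tracePairing_of_isMinOn_dressed` with the competitor set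
`T_𝔰𝔲 = {X | X bondwise self-adjoint ∧ bondwise traceless ∧ (∀ c, Q_{j(c)}X(c) = B(c)) ∧ X ∈ S₀}`, the minimiser `A` bondwise traceless, and the conclusion for every
self-adjoint TRACELESS `Et`: if `A` minimises `X ↦ Re S(X − H(D X))` over `T_𝔰𝔲`, the trace pairing of `(A, W₀(A − H(D A)) + E A)` vanishes on `ker Q` against `s•Et`.
[cite: Balaban1985Variational, (80)-(89) pp.290-291, (99)-(100) p.293, (127) p.297, (157)-(158) p.302] -/
theorem tracePairing_of_isMinOn_dressed_su2 (Dm : Domains P) (η : ℝ) (hη : η ≠ 0) (S : (PBond P 0 → Matrix (Fin 2) (Fin 2) ℂ) → ℂ)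
    (W₀ : (PBond P 0 → Matrix (Fin 2) (Fin 2) ℂ) → (PBond P 0 → Matrix (Fin 2) (Fin 2) ℂ)) (hSd : Differentiable ℂ S)
    (hgrad : ∀ A δ : PBond P 0 → Matrix (Fin 2) (Fin 2) ℂ, fderiv ℂ S A δ =
      ((η : ℂ) ^ 2 / 2) * ∑ p : Plaq P 0, Matrix.trace ((A ⟨p.src, p.μ⟩ + A ⟨p.src.shift p.μ, p.ν⟩ - A ⟨p.src.shift p.ν, p.μ⟩ - A ⟨p.src, p.ν⟩) * (δ ⟨p.src, p.μ⟩ + δ ⟨p.src.shift p.μ, p.ν⟩ - δ ⟨p.src.shift p.ν, p.μ⟩ - δ ⟨p.src, p.ν⟩)) + (η : ℂ) ^ 4 * ∑ b : PBond P 0, Matrix.trace (W₀ A b * δ b))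
    (H : (β' → Matrix (Fin 2) (Fin 2) ℂ) →ₗ[ℂ] (PBond P 0 → Matrix (Fin 2) (Fin 2) ℂ))
    (D : (PBond P 0 → Matrix (Fin 2) (Fin 2) ℂ) → (β' → Matrix (Fin 2) (Fin 2) ℂ))
    (E : (PBond P 0 → Matrix (Fin 2) (Fin 2) ℂ) → (PBond P 0 → Matrix (Fin 2) (Fin 2) ℂ))
    (hE : ∀ (Y : PBond P 0 → Matrix (Fin 2) (Fin 2) ℂ) (b : PBond P 0) (i j : Fin 2), E Y b i j = ((η : ℂ) ^ 4)⁻¹ *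
      (-(((η : ℂ) ^ 2 / 2) * ∑ p : Plaq P 0, Matrix.trace ((H (D Y) ⟨p.src, p.μ⟩ + H (D Y) ⟨p.src.shift p.μ, p.ν⟩ - H (D Y) ⟨p.src.shift p.ν, p.μ⟩ - H (D Y) ⟨p.src, p.ν⟩) *
          ((Pi.single b (Matrix.single j i (1 : ℂ)) : PBond P 0 → Matrix (Fin 2) (Fin 2) ℂ) ⟨p.src, p.μ⟩ + (Pi.single b (Matrix.single j i (1 : ℂ)) : PBond P 0 → Matrix (Fin 2) (Fin 2) ℂ) ⟨p.src.shift p.μ, p.ν⟩ -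
            (Pi.single b (Matrix.single j i (1 : ℂ)) : PBond P 0 → Matrix (Fin 2) (Fin 2) ℂ) ⟨p.src.shift p.ν, p.μ⟩ - (Pi.single b (Matrix.single j i (1 : ℂ)) : PBond P 0 → Matrix (Fin 2) (Fin 2) ℂ) ⟨p.src, p.ν⟩)))
        - ((η : ℂ) ^ 2 / 2) * ∑ p : Plaq P 0, Matrix.trace (((Y - H (D Y)) ⟨p.src, p.μ⟩ + (Y - H (D Y)) ⟨p.src.shift p.μ, p.ν⟩ - (Y - H (D Y)) ⟨p.src.shift p.ν, p.μ⟩ - (Y - H (D Y)) ⟨p.src, p.ν⟩) *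
          (H (fderiv ℂ D Y (Pi.single b (Matrix.single j i (1 : ℂ)))) ⟨p.src, p.μ⟩ + H (fderiv ℂ D Y (Pi.single b (Matrix.single j i (1 : ℂ)))) ⟨p.src.shift p.μ, p.ν⟩ -
            H (fderiv ℂ D Y (Pi.single b (Matrix.single j i (1 : ℂ)))) ⟨p.src.shift p.ν, p.μ⟩ - H (fderiv ℂ D Y (Pi.single b (Matrix.single j i (1 : ℂ)))) ⟨p.src, p.ν⟩))
        - (η : ℂ) ^ 4 * ∑ b' : PBond P 0, Matrix.trace (W₀ (Y - H (D Y)) b' * H (fderiv ℂ D Y (Pi.single b (Matrix.single j i (1 : ℂ)))) b')))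
    {S₀ : Set (PBond P 0 → Matrix (Fin 2) (Fin 2) ℂ)} {Bdat : BondIdx Dm → Matrix (Fin 2) (Fin 2) ℂ}
    {A : PBond P 0 → Matrix (Fin 2) (Fin 2) ℂ} (hAsa : ∀ b, IsSelfAdjoint (A b)) (hAtr : ∀ b, Matrix.trace (A b) = 0) (hAQ : ∀ c : BondIdx Dm, bondAvgIter (c.1.1 : ℕ) A c.1.2 = Bdat c)
    (hS₀ : ∀ δ : PBond P 0 → Matrix (Fin 2) (Fin 2) ℂ, ∃ r : ℝ, 0 < r ∧ ∀ t : ℝ, |t| < r → A + t • δ ∈ S₀)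
    (hD : DifferentiableAt ℂ D A)
    (hmin : IsMinOn (fun X => (S (X - H (D X))).re) {X : PBond P 0 → Matrix (Fin 2) (Fin 2) ℂ | (∀ b, IsSelfAdjoint (X b)) ∧ (∀ b, Matrix.trace (X b) = 0) ∧ (∀ c : BondIdx Dm, bondAvgIter (c.1.1 : ℕ) X c.1.2 = Bdat c) ∧ X ∈ S₀} A) :
    ∀ s : PBond P 0 → ℝ, QE Dm (WithLp.toLp 2 s) = 0 → ∀ Et : Matrix (Fin 2) (Fin 2) ℂ, IsSelfAdjoint Et → Matrix.trace Et = 0 →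
    (((η : ℂ) ^ 2 / 2) * ∑ p : Plaq P 0, Matrix.trace ((A ⟨p.src, p.μ⟩ + A ⟨p.src.shift p.μ, p.ν⟩ - A ⟨p.src.shift p.ν, p.μ⟩ - A ⟨p.src, p.ν⟩) * (((s ⟨p.src, p.μ⟩ : ℝ) : ℂ) • Et + ((s ⟨p.src.shift p.μ, p.ν⟩ : ℝ) : ℂ) • Et - ((s ⟨p.src.shift p.ν, p.μ⟩ : ℝ) : ℂ) • Et - ((s ⟨p.src, p.ν⟩ : ℝ) : ℂ) • Et)) +
      (η : ℂ) ^ 4 * ∑ b : PBond P 0, Matrix.trace ((W₀ (A - H (D A)) b + E A b) * (((s b : ℝ) : ℂ) • Et))).re = 0 := by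
  intro s hs Et hEt hEttr
  obtain ⟨r, hr, hSr⟩ := hS₀ (fun b => ((s b : ℝ) : ℂ) • Et)
  have hQs : ∀ c : BondIdx Dm, bondAvgIter (c.1.1 : ℕ) s c.1.2 = 0 := fun c => by
    have h := congrArg (fun v : B6SectAOperatorsV1.BondIdxSpace Dm => v c) hs
    simpa [QE_apply] using h
  have hδφ : (fun b => ((s b : ℝ) : ℂ) • Et) = fun b => (LinearMap.toSpanSingleton ℝ (Matrix (Fin 2) (Fin 2) ℂ) Et) (s b) := by
    funext b
    rw [LinearMap.toSpanSingleton_apply, Complex.coe_smul]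
  have hT : ∀ t : ℝ, |t| < r → A + t • (fun b => ((s b : ℝ) : ℂ) • Et) ∈ {X : PBond P 0 → Matrix (Fin 2) (Fin 2) ℂ | (∀ b, IsSelfAdjoint (X b)) ∧ (∀ b, Matrix.trace (X b) = 0) ∧ (∀ c : BondIdx Dm, bondAvgIter (c.1.1 : ℕ) X c.1.2 = Bdat c) ∧ X ∈ S₀} := by
    intro t ht
    refine ⟨fun b => ?_, fun b => ?_, fun c => ?_, hSr t ht⟩
    · show IsSelfAdjoint (A b + t • (((s b : ℝ) : ℂ) • Et))
      rw [Complex.coe_smul]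
      exact (hAsa b).add (IsSelfAdjoint.smul (IsSelfAdjoint.all t) (IsSelfAdjoint.smul (IsSelfAdjoint.all (s b)) hEt))
    · show Matrix.trace (A b + t • (((s b : ℝ) : ℂ) • Et)) = 0
      rw [Matrix.trace_add, Matrix.trace_smul, Matrix.trace_smul, hAtr b, hEttr, smul_zero, smul_zero, add_zero]
    · rw [bondAvgIter_add, bondAvgIter_smul, Pi.add_apply, Pi.smul_apply, hAQ c, hδφ,
        ChartHInv.bondAvgIter_comp_apply (LinearMap.toSpanSingleton ℝ (Matrix (Fin 2) (Fin 2) ℂ) Et) (c.1.1 : ℕ) s c.1.2, hQs c, map_zero, smul_zero, add_zero]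
  have hg : DifferentiableAt ℂ (fun X => S (X - H (D X))) A := differentiableAt_dressed S H D hD (hSd _)
  have key := re_fderiv_eq_zero_of_isMinOn_segment hg hr hT hmin
  rw [fderiv_dressed_eq_pairing η hη S W₀ hSd hgrad H D E hE hD] at key
  exact key

/-- **THE SAME FROM A MINIMUM OF THE TREE'S `wilsonAction4` THROUGH THE DRESSED CHART** `↑(U X)(b) = e^{iη(X − H(D X))(b)}` on `T` (the charted competitors are
bondwise self-adjoint): `S = 𝒮_η`, `FlatActionGradient.wilsonAction4_eq_re_action`.  This is the P5 entry point: the route's minimiser read in the (47)-chart of the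
cube sequence ([B8] Thm 2, P1) is such a minimum (print (157)). [cite: Balaban1985Variational, (5) p.278, (47) p.285, (157)-(158) p.302] -/
theorem tracePairing_of_isMinOn_dressed_wilson_su2 (Dm : Domains P) (η : ℝ) (hη : η ≠ 0)
    (W₀ : (PBond P 0 → Matrix (Fin 2) (Fin 2) ℂ) → (PBond P 0 → Matrix (Fin 2) (Fin 2) ℂ)) (hSd : Differentiable ℂ (fun A : PBond P 0 → Matrix (Fin 2) (Fin 2) ℂ => (∑ p : Plaq P 0, (1 - (2 : ℂ)⁻¹ * Matrix.trace (exp ((Complex.I * (η : ℂ)) • A ⟨p.src, p.μ⟩) * exp ((Complex.I * (η : ℂ)) • A ⟨p.src.shift p.μ, p.ν⟩) * exp (-((Complex.I * (η : ℂ)) • A ⟨p.src.shift p.ν, p.μ⟩)) * exp (-((Complex.I * (η : ℂ)) • A ⟨p.src, p.ν⟩)))))))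
    (hgrad : ∀ A δ : PBond P 0 → Matrix (Fin 2) (Fin 2) ℂ, fderiv ℂ (fun A : PBond P 0 → Matrix (Fin 2) (Fin 2) ℂ => (∑ p : Plaq P 0, (1 - (2 : ℂ)⁻¹ * Matrix.trace (exp ((Complex.I * (η : ℂ)) • A ⟨p.src, p.μ⟩) * exp ((Complex.I * (η : ℂ)) • A ⟨p.src.shift p.μ, p.ν⟩) * exp (-((Complex.I * (η : ℂ)) • A ⟨p.src.shift p.ν, p.μ⟩)) * exp (-((Complex.I * (η : ℂ)) • A ⟨p.src, p.ν⟩)))))) A δ =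
      ((η : ℂ) ^ 2 / 2) * ∑ p : Plaq P 0, Matrix.trace ((A ⟨p.src, p.μ⟩ + A ⟨p.src.shift p.μ, p.ν⟩ - A ⟨p.src.shift p.ν, p.μ⟩ - A ⟨p.src, p.ν⟩) * (δ ⟨p.src, p.μ⟩ + δ ⟨p.src.shift p.μ, p.ν⟩ - δ ⟨p.src.shift p.ν, p.μ⟩ - δ ⟨p.src, p.ν⟩)) + (η : ℂ) ^ 4 * ∑ b : PBond P 0, Matrix.trace (W₀ A b * δ b))
    (H : (β' → Matrix (Fin 2) (Fin 2) ℂ) →ₗ[ℂ] (PBond P 0 → Matrix (Fin 2) (Fin 2) ℂ))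
    (D : (PBond P 0 → Matrix (Fin 2) (Fin 2) ℂ) → (β' → Matrix (Fin 2) (Fin 2) ℂ))
    (E : (PBond P 0 → Matrix (Fin 2) (Fin 2) ℂ) → (PBond P 0 → Matrix (Fin 2) (Fin 2) ℂ))
    (hE : ∀ (Y : PBond P 0 → Matrix (Fin 2) (Fin 2) ℂ) (b : PBond P 0) (i j : Fin 2), E Y b i j = ((η : ℂ) ^ 4)⁻¹ *
      (-(((η : ℂ) ^ 2 / 2) * ∑ p : Plaq P 0, Matrix.trace ((H (D Y) ⟨p.src, p.μ⟩ + H (D Y) ⟨p.src.shift p.μ, p.ν⟩ - H (D Y) ⟨p.src.shift p.ν, p.μ⟩ - H (D Y) ⟨p.src, p.ν⟩) *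
          ((Pi.single b (Matrix.single j i (1 : ℂ)) : PBond P 0 → Matrix (Fin 2) (Fin 2) ℂ) ⟨p.src, p.μ⟩ + (Pi.single b (Matrix.single j i (1 : ℂ)) : PBond P 0 → Matrix (Fin 2) (Fin 2) ℂ) ⟨p.src.shift p.μ, p.ν⟩ -
            (Pi.single b (Matrix.single j i (1 : ℂ)) : PBond P 0 → Matrix (Fin 2) (Fin 2) ℂ) ⟨p.src.shift p.ν, p.μ⟩ - (Pi.single b (Matrix.single j i (1 : ℂ)) : PBond P 0 → Matrix (Fin 2) (Fin 2) ℂ) ⟨p.src, p.ν⟩)))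
        - ((η : ℂ) ^ 2 / 2) * ∑ p : Plaq P 0, Matrix.trace (((Y - H (D Y)) ⟨p.src, p.μ⟩ + (Y - H (D Y)) ⟨p.src.shift p.μ, p.ν⟩ - (Y - H (D Y)) ⟨p.src.shift p.ν, p.μ⟩ - (Y - H (D Y)) ⟨p.src, p.ν⟩) *
          (H (fderiv ℂ D Y (Pi.single b (Matrix.single j i (1 : ℂ)))) ⟨p.src, p.μ⟩ + H (fderiv ℂ D Y (Pi.single b (Matrix.single j i (1 : ℂ)))) ⟨p.src.shift p.μ, p.ν⟩ -
            H (fderiv ℂ D Y (Pi.single b (Matrix.single j i (1 : ℂ)))) ⟨p.src.shift p.ν, p.μ⟩ - H (fderiv ℂ D Y (Pi.single b (Matrix.single j i (1 : ℂ)))) ⟨p.src, p.ν⟩))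
        - (η : ℂ) ^ 4 * ∑ b' : PBond P 0, Matrix.trace (W₀ (Y - H (D Y)) b' * H (fderiv ℂ D Y (Pi.single b (Matrix.single j i (1 : ℂ)))) b')))
    {S₀ : Set (PBond P 0 → Matrix (Fin 2) (Fin 2) ℂ)} {Bdat : BondIdx Dm → Matrix (Fin 2) (Fin 2) ℂ}
    (U : (PBond P 0 → Matrix (Fin 2) (Fin 2) ℂ) → GaugeField P 0 (Matrix.specialUnitaryGroup (Fin 2) ℂ))
    (hΨsa : ∀ X ∈ {X : PBond P 0 → Matrix (Fin 2) (Fin 2) ℂ | (∀ b, IsSelfAdjoint (X b)) ∧ (∀ b, Matrix.trace (X b) = 0) ∧ (∀ c : BondIdx Dm, bondAvgIter (c.1.1 : ℕ) X c.1.2 = Bdat c) ∧ X ∈ S₀}, ∀ b, IsSelfAdjoint ((X - H (D X)) b))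
    (hU : ∀ X ∈ {X : PBond P 0 → Matrix (Fin 2) (Fin 2) ℂ | (∀ b, IsSelfAdjoint (X b)) ∧ (∀ b, Matrix.trace (X b) = 0) ∧ (∀ c : BondIdx Dm, bondAvgIter (c.1.1 : ℕ) X c.1.2 = Bdat c) ∧ X ∈ S₀}, ∀ b, ((U X b : Matrix.specialUnitaryGroup (Fin 2) ℂ) : Matrix (Fin 2) (Fin 2) ℂ) = exp ((Complex.I * (η : ℂ)) • (X - H (D X)) b))
    {A : PBond P 0 → Matrix (Fin 2) (Fin 2) ℂ} (hAsa : ∀ b, IsSelfAdjoint (A b)) (hAtr : ∀ b, Matrix.trace (A b) = 0) (hAQ : ∀ c : BondIdx Dm, bondAvgIter (c.1.1 : ℕ) A c.1.2 = Bdat c) (hAS : A ∈ S₀)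
    (hS₀ : ∀ δ : PBond P 0 → Matrix (Fin 2) (Fin 2) ℂ, ∃ r : ℝ, 0 < r ∧ ∀ t : ℝ, |t| < r → A + t • δ ∈ S₀)
    (hD : DifferentiableAt ℂ D A)
    (hmin : IsMinOn (fun X => wilsonAction4 (U X)) {X : PBond P 0 → Matrix (Fin 2) (Fin 2) ℂ | (∀ b, IsSelfAdjoint (X b)) ∧ (∀ b, Matrix.trace (X b) = 0) ∧ (∀ c : BondIdx Dm, bondAvgIter (c.1.1 : ℕ) X c.1.2 = Bdat c) ∧ X ∈ S₀} A) :
    ∀ s : PBond P 0 → ℝ, QE Dm (WithLp.toLp 2 s) = 0 → ∀ Et : Matrix (Fin 2) (Fin 2) ℂ, IsSelfAdjoint Et → Matrix.trace Et = 0 →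
    (((η : ℂ) ^ 2 / 2) * ∑ p : Plaq P 0, Matrix.trace ((A ⟨p.src, p.μ⟩ + A ⟨p.src.shift p.μ, p.ν⟩ - A ⟨p.src.shift p.ν, p.μ⟩ - A ⟨p.src, p.ν⟩) * (((s ⟨p.src, p.μ⟩ : ℝ) : ℂ) • Et + ((s ⟨p.src.shift p.μ, p.ν⟩ : ℝ) : ℂ) • Et - ((s ⟨p.src.shift p.ν, p.μ⟩ : ℝ) : ℂ) • Et - ((s ⟨p.src, p.ν⟩ : ℝ) : ℂ) • Et)) +
      (η : ℂ) ^ 4 * ∑ b : PBond P 0, Matrix.trace ((W₀ (A - H (D A)) b + E A b) * (((s b : ℝ) : ℂ) • Et))).re = 0 := by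
  have hmin' : IsMinOn (fun X => ((fun A : PBond P 0 → Matrix (Fin 2) (Fin 2) ℂ => (∑ p : Plaq P 0, (1 - (2 : ℂ)⁻¹ * Matrix.trace (exp ((Complex.I * (η : ℂ)) • A ⟨p.src, p.μ⟩) * exp ((Complex.I * (η : ℂ)) • A ⟨p.src.shift p.μ, p.ν⟩) * exp (-((Complex.I * (η : ℂ)) • A ⟨p.src.shift p.ν, p.μ⟩)) * exp (-((Complex.I * (η : ℂ)) • A ⟨p.src, p.ν⟩)))))) (X - H (D X))).re) {X : PBond P 0 → Matrix (Fin 2) (Fin 2) ℂ | (∀ b, IsSelfAdjoint (X b)) ∧ (∀ b, Matrix.trace (X b) = 0) ∧ (∀ c : BondIdx Dm, bondAvgIter (c.1.1 : ℕ) X c.1.2 = Bdat c) ∧ X ∈ S₀} A := by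
    intro X hX
    have hXe := wilsonAction4_eq_re_action η (X - H (D X)) (hΨsa X hX) (U X) (hU X hX)
    have hAe := wilsonAction4_eq_re_action η (A - H (D A)) (hΨsa A ⟨hAsa, hAtr, hAQ, hAS⟩) (U A) (hU A ⟨hAsa, hAtr, hAQ, hAS⟩)
    have h := hmin hX
    simp only [Set.mem_setOf_eq] at h ⊢
    rw [← hXe, ← hAe]
    exact h
  exact tracePairing_of_isMinOn_dressed_su2 Dm η hη (fun A : PBond P 0 → Matrix (Fin 2) (Fin 2) ℂ => (∑ p : Plaq P 0, (1 - (2 : ℂ)⁻¹ * Matrix.trace (exp ((Complex.I * (η : ℂ)) • A ⟨p.src, p.μ⟩) * exp ((Complex.I * (η : ℂ)) • A ⟨p.src.shift p.μ, p.ν⟩) * exp (-((Complex.I * (η : ℂ)) • A ⟨p.src.shift p.ν, p.μ⟩)) * exp (-((Complex.I * (η : ℂ)) • A ⟨p.src, p.ν⟩)))))) W₀ hSd hgrad H D E hE hAsa hAtr hAQ hS₀ hD hmin'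

end Minimality

end Summit.QuantumFields.YangMills.Theorems.HalvingDressedCriticalitySU2

end
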